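import Mathlib
import HarnessLib
import Summits.Ventures.LatticeQCDFlow.Exactness.NCMCGeneralSpaceRatioStudentizedCLT
import Summits.Ventures.LatticeQCDFlow.Exactness.NCMCGeneralSpaceAcceptanceCLT

/-!
# The studentized CLT for a sample mean and the plug-in error bar of the reported acceptance

HONEST FRAMING: exact (Metropolis-corrected) sampling algorithms for lattice gauge theory;
figures of merit are autocorrelation/cost numbers at stated couplings and volumes; no
continuum-physics claim.

Venture `LatticeQCDFlow` (cell pub-lqcd), topic `Exactness`; FANOUT row 13 (`eng-snf`, GEN-14).
NEW WORK of the cell (elementary asymptotic statistics, assembled from Mathlib and the cell's own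
files), not a published result; nothing is cited as a fact ("Student"/W. S. Gosset 1908 and
E. Slutsky 1925 named only).  Continuation of `NCMCGeneralSpaceRatioStudentizedCLT.lean` (GEN-14:
the studentized CLT for a self-normalised ratio `A_n/B_n`), specialised to `b ≡ 1` — the plain
STUDENTIZED SAMPLE MEAN — and of `NCMCGeneralSpaceAcceptanceCLT.lean` (GEN-13:
`√n (ᾱ_n − a_F(c)) →d N(0, Var_F[α])`) and `NCMCGeneralSpaceAcceptanceBennett.lean` (GEN-14:
Bernstein tails with a variance proxy `v ≥ Var_F[α]` that must be SUPPLIED).  This file closes the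
loop asymptotically: the sample variance of the acceptance probabilities is a consistent plug-in, so
the reported acceptance with its plug-in standard error is an asymptotically exact pivot.

## Setting and content

`μ` a probability law on records `E`, runs `ω : ℕ → E` under `Measure.infinitePi (fun _ => μ)`,
a measurable `g ∈ L²(μ)` with `Var_μ[g] > 0`; `ḡ_n = (1/n) Σ_{i<n} g(ω i)` and the plug-in
standard error `se_n = √(Σ_{i<n} (g(ω i) − ḡ_n)²) / n` (`= ŝ_n/√n` with `ŝ_n² = (1/n) Σ (g − ḡ_n)²`).

* **`tendstoInDistribution_studentized_sampleMean`** — THE STUDENTIZED CLT: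
  `(ḡ_n − E_μ g)/se_n →d N(0, 1)` (the ratio file with `b ≡ 1`: `B_n = n`, `r̂_n = ḡ_n`,
  `Var_μ[g − E g] = Var_μ[g]`); **`tendsto_measure_abs_studentized_sampleMean_le`** — COVERAGE:
  `μ^{⊗ℕ}{|(ḡ_n − E_μ g)/se_n| ≤ z} → gaussianReal 0 1 [−z, z]`.
* For a Crooks pair `(κF, κR, s, e, W)` from `ν₀` to `ν₁`, a level constant `c`, the acceptance
  probabilities `α_i = min(1, e^{−(W_i − c)})` of independent forward evolutions with
  `Var_F[α] > 0` (the acceptance probability is not `P_F`-a.s. constant), their running mean `ᾱ_n`,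
  population mean `a_F(c)` and plug-in standard error `se_n = √(Σ_{i<n} (α_i − ᾱ_n)²)/n`:
  **`CrooksPair.tendstoInDistribution_accept_studentized`** — `(ᾱ_n − a_F(c))/se_n →d N(0, 1)`;
  **`CrooksPair.tendsto_measure_abs_accept_sub_le_se`** — the probability that
  `|(ᾱ_n − a_F(c))/se_n| ≤ z` tends to `N(0,1)([−z, z])`: THE REPORTED ACCEPTANCE WITH ITS PLUG-IN
  STANDARD ERROR IS ASYMPTOTICALLY HONEST, whatever the protocol.
  Reading for the engine (boarded `acceptance`, `ncmc.c` pilots): report `ᾱ ± z·se` with `se` the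
  sample standard deviation of the acceptance PROBABILITIES over `√N`; for a nearly quasi-static
  protocol this is far tighter than the Bernoulli `√(ᾱ(1 − ᾱ)/N)` of the accept/reject count, and
  it is the asymptotically exact width (GEN-14's Bennett file gives the finite-`N` version for a
  supplied variance bound).

Scope / NOT CLAIMED: independent evolutions only; asymptotic coverage only — no finite-`N`
guarantee and no rate; the degenerate case `Var = 0` (a.s. constant acceptance probability, e.g. a
dissipation-free protocol) is excluded; no value for any concrete protocol.
-/

namespace Summit.Ventures.LatticeQCDFlow.Exactness.GeneralNCMC

open MeasureTheory ProbabilityTheory Set Filter Finset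
open scoped ENNReal NNReal Topology

variable {E : Type*} [MeasurableSpace E]

section IID

variable (μ : Measure E) [IsProbabilityMeasure μ]
variable {Ω' : Type*} [MeasurableSpace Ω'] {P' : Measure Ω'} [IsProbabilityMeasure P']

/-! ## The studentized CLT for the sample mean of an i.i.d. run -/

/-- **Studentized CLT for a sample mean.**  For a measurable `g ∈ L²(μ)` with `Var_μ[g] > 0`, along
an infinite i.i.d. run `(ḡ_n − E_μ g)/se_n →d N(0, 1)`, `ḡ_n = (1/n) Σ_{i<n} g(ω i)`,
`se_n = √(Σ_{i<n} (g(ω i) − ḡ_n)²)/n` (the self-normalised-ratio file with `b ≡ 1`). -/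
theorem tendstoInDistribution_studentized_sampleMean {g : E → ℝ} (hg : Measurable g)
    (hL2 : MemLp g 2 μ) (hvar : 0 < Var[g; μ]) {Z : Ω' → ℝ} (hZ : HasLaw Z (gaussianReal 0 1) P') :
    TendstoInDistribution
      (fun (n : ℕ) (ω : ℕ → E) =>
        ((∑ i ∈ range n, g (ω i)) / n - ∫ x, g x ∂μ) /
          (√(∑ i ∈ range n, (g (ω i) - (∑ j ∈ range n, g (ω j)) / n) ^ 2) / n))
      atTop Z (fun _ => Measure.infinitePi fun _ : ℕ => μ) P' := by
  have hσ : 0 < Var[fun x => g x - (∫ x, g x ∂μ) / (∫ _x, (1 : ℝ) ∂μ) * (1 : ℝ); μ] := by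
    simp only [integral_const, smul_eq_mul, probReal_univ, div_one, mul_one]
    rwa [variance_sub_const hg.aestronglyMeasurable]
  have main := tendstoInDistribution_studentized_ratio μ (b := fun _ => (1 : ℝ)) hg measurable_const
    (fun _ => one_pos) hL2 (memLp_const 1) hσ hZ
  refine main.congr (fun n => Eventually.of_forall fun ω => ?_) (Eventually.of_forall fun _ => rfl)
  beta_reduce
  simp only [Finset.sum_const, Finset.card_range, nsmul_eq_mul, mul_one, integral_const, smul_eq_mul,
    probReal_univ, div_one]
  rw [div_div_eq_mul_div]

/-- **Coverage of `ḡ_n ± z·se_n`.**  For `z ≥ 0`,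
`μ^{⊗ℕ} {|(ḡ_n − E_μ g)/se_n| ≤ z} → gaussianReal 0 1 [−z, z]` (portmanteau). -/
theorem tendsto_measure_abs_studentized_sampleMean_le {g : E → ℝ} (hg : Measurable g)
    (hL2 : MemLp g 2 μ) (hvar : 0 < Var[g; μ]) {z : ℝ} (hz : 0 ≤ z) :
    Tendsto (fun n : ℕ => (Measure.infinitePi fun _ : ℕ => μ)
        {ω | |((∑ i ∈ range n, g (ω i)) / n - ∫ x, g x ∂μ) /
          (√(∑ i ∈ range n, (g (ω i) - (∑ j ∈ range n, g (ω j)) / n) ^ 2) / n)| ≤ z})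
      atTop (𝓝 (gaussianReal 0 1 (Icc (-z) z))) := by
  have h := tendstoInDistribution_studentized_sampleMean μ hg hL2 hvar
    (P' := gaussianReal 0 1) (Z := id) HasLaw.id
  have hnull : ((gaussianReal 0 1).map id) (frontier (Icc (-z) z)) = 0 := by
    rw [Measure.map_id, frontier_Icc (by linarith : -z ≤ z)]
    haveI := nullSingletonClass_gaussianReal (μ := 0) (v := 1) one_ne_zero
    exact (Set.toFinite {-z, z}).measure_zero _
  have key := ProbabilityMeasure.tendsto_measure_of_null_frontier_of_tendsto' h.tendsto
    (E := Icc (-z) z) (by simpa using hnull)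
  simp only [ProbabilityMeasure.coe_mk, Measure.map_id] at key
  refine key.congr fun n => ?_
  rw [Measure.map_apply_of_aemeasurable (h.forall_aemeasurable n) measurableSet_Icc]
  congr 1
  ext ω
  simp only [Set.mem_preimage, Set.mem_Icc, mem_setOf_eq, abs_le]

end IID

/-! ## For a Crooks pair: the reported acceptance with its plug-in standard error is an asymptotic pivot -/

namespace CrooksPair

variable {Ω : Type*} [MeasurableSpace Ω]
variable {ν₀ ν₁ : Measure Ω} {κF κR : Kernel Ω E} {s e : E → Ω} {W : E → ℝ}
variable {Ω' : Type*} [MeasurableSpace Ω'] {P' : Measure Ω'} [IsProbabilityMeasure P']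

/-- **Studentized CLT for the reported acceptance of a Crooks pair.**  For every Crooks pair, every
level constant `c` with `Var_F[min(1, e^{−(W−c)})] > 0`, along an infinite run of independent
forward evolutions from prior equilibrium: `(ᾱ_n − a_F(c))/se_n →d N(0, 1)` with `ᾱ_n` the mean of
the first `n` acceptance probabilities and `se_n = √(Σ_{i<n} (α_i − ᾱ_n)²)/n`. -/
theorem tendstoInDistribution_accept_studentized [IsFiniteMeasure ν₀] [IsMarkovKernel κF]
    (h0 : ν₀ univ ≠ 0) (h : CrooksPair ν₀ ν₁ κF κR s e W) (c : ℝ)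
    (hvar : 0 < Var[fun ε => min 1 (Real.exp (-(W ε - c))); fwdPathLaw ν₀ κF]) {Z : Ω' → ℝ}
    (hZ : HasLaw Z (gaussianReal 0 1) P') :
    haveI := isProbabilityMeasure_fwdPathLaw ν₀ h0 κF
    TendstoInDistribution
      (fun (n : ℕ) (ω : ℕ → E) =>
        ((∑ i ∈ range n, min 1 (Real.exp (-(W (ω i) - c)))) / n -
            ∫ ε, min 1 (Real.exp (-(W ε - c))) ∂(fwdPathLaw ν₀ κF)) /
          (√(∑ i ∈ range n, (min 1 (Real.exp (-(W (ω i) - c))) -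
              (∑ j ∈ range n, min 1 (Real.exp (-(W (ω j) - c)))) / n) ^ 2) / n))
      atTop Z (fun _ => Measure.infinitePi fun _ : ℕ => fwdPathLaw ν₀ κF) P' := by
  haveI := isProbabilityMeasure_fwdPathLaw ν₀ h0 κF
  exact tendstoInDistribution_studentized_sampleMean (fwdPathLaw ν₀ κF)
    (measurable_accept_mem_Icc h.measurable_W c).1
    (memLp_two_of_mem_Icc (fwdPathLaw ν₀ κF) (measurable_accept_mem_Icc h.measurable_W c).1
      (measurable_accept_mem_Icc h.measurable_W c).2) hvar hZ

/-- **The reported acceptance `ᾱ ± z·se` is asymptotically honest.**  Under the same hypotheses,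
for every `z ≥ 0` the probability that `|(ᾱ_n − a_F(c))/se_n| ≤ z` — i.e. that `a_F(c)` lies in
`[ᾱ_n − z se_n, ᾱ_n + z se_n]` whenever `se_n > 0` — converges to `gaussianReal 0 1 [−z, z]`. -/
theorem tendsto_measure_abs_accept_sub_le_se [IsFiniteMeasure ν₀] [IsMarkovKernel κF]
    (h0 : ν₀ univ ≠ 0) (h : CrooksPair ν₀ ν₁ κF κR s e W) (c : ℝ)
    (hvar : 0 < Var[fun ε => min 1 (Real.exp (-(W ε - c))); fwdPathLaw ν₀ κF]) {z : ℝ}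
    (hz : 0 ≤ z) :
    haveI := isProbabilityMeasure_fwdPathLaw ν₀ h0 κF
    Tendsto (fun n : ℕ => (Measure.infinitePi fun _ : ℕ => fwdPathLaw ν₀ κF)
        {ω | |((∑ i ∈ range n, min 1 (Real.exp (-(W (ω i) - c)))) / n -
            ∫ ε, min 1 (Real.exp (-(W ε - c))) ∂(fwdPathLaw ν₀ κF)) /
          (√(∑ i ∈ range n, (min 1 (Real.exp (-(W (ω i) - c))) -
              (∑ j ∈ range n, min 1 (Real.exp (-(W (ω j) - c)))) / n) ^ 2) / n)| ≤ z})
      atTop (𝓝 (gaussianReal 0 1 (Icc (-z) z))) := by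
  haveI := isProbabilityMeasure_fwdPathLaw ν₀ h0 κF
  exact tendsto_measure_abs_studentized_sampleMean_le (fwdPathLaw ν₀ κF)
    (measurable_accept_mem_Icc h.measurable_W c).1
    (memLp_two_of_mem_Icc (fwdPathLaw ν₀ κF) (measurable_accept_mem_Icc h.measurable_W c).1
      (measurable_accept_mem_Icc h.measurable_W c).2) hvar hz

end CrooksPair

end Summit.Ventures.LatticeQCDFlow.Exactness.GeneralNCMC
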